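import Summits.QuantumFields.YangMills.Theses.SmallCircleAnchor
import Summits.QuantumFields.YangMills.Theorems.SmallCircleAnchorEndpointTransfer

/-!
# Reducibility test for the stub `stub_deformationRemoval` (crux `AdiabaticContinuity`,
# stmt-QuantumFields-11142, line `registered`, reshape r1) — SCRATCH, lead c2, NOT proposed

Question: is the registered stub statement `DeformationRemoval` (R, Leg B; copied VERBATIM below from
`Cruxes/AdiabaticContinuity/Lines/birth.lean` ll. 126–159) implied by the hub's EXISTING open items
`AnchorGap` (stmt-QuantumFields-11141) and `UniformLatticeGap` (stmt-QuantumFields-8778)?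
Method as in the worker's `stub_thermalContinuationUniform.reduce.lean`: intro everything, instantiate both
items as close to the goal as their prefixes allow, stop at the first goal nothing closes (`sorry`, by design);
verbatim residual goal in `stub_deformationRemoval.reduce.goal.txt`, diagnosis in NOTES.md / the lead report.
-/

namespace Summit.QuantumFields.YangMills.Theorems.SmallCircleAnchor

open scoped BigOperators Topology Manifold Classical MeasureTheory ProbabilityTheory Matrix InnerProductSpace ComplexConjugate ContinuousMap
open Filter Set Function TopologicalSpace MeasureTheory

/-- **Stub R — deformation removal at zero temperature (Leg B).** For every `G, r`, abelianising `V`,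
every schedule `E` and threshold `β₂`: if for all `β ≥ β₂` the fully deformed (`s = E(β)`) theory on the
symmetric torus `ℤ_L × (ℤ/L)³` clusters uniformly in `L`, then there is `β₃` such that for all `β ≥ β₃`
ONE rate `m > 0` clusters the `(L, s·V)`-theory uniformly in `L` for EVERY `s ∈ [0, E(β)]` — down to the
undeformed Wilson torus `s = 0` (whence `UniformLatticeGap` by the proved support `EndpointTransfer`).
(At zero temperature the pinning of Polyakov lines of length `L → ∞` is a boundary-like perturbation of
an unbroken-centre bulk; kill: a bulk first-order transition in `s`.) -/
def DeformationRemoval : Prop :=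
  ∀ (G : Type) [Group G] [TopologicalSpace G] [IsTopologicalGroup G] [CompactSpace G],
    Literature.MathematicalPhysics.QuantumFieldTheory.IsCompactSimpleLieGroup G →
    letI : MeasurableSpace G := borel G; haveI : BorelSpace G := ⟨rfl⟩;
    ∀ (r : Literature.MathematicalPhysics.QuantumFieldTheory.LatticeRep G) (V : G → ℝ),
    (Continuous V ∧ (∀ a g : G, V (a * g * a⁻¹) = V g) ∧ ∃ g₀ : G, (∀ g : G, V g₀ ≤ V g) ∧ (∀ g : G, V g = V g₀ → ∃ a : G, g = a * g₀ * a⁻¹) ∧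
      (∀ a b : G, a * g₀ = g₀ * a → b * g₀ = g₀ * b → a * b = b * a)) →
    let Cl := fun (τ : ℕ → ℕ) (s β m : ℝ) =>
      ∀ w : ℕ, ∃ C : ℝ, ∀ (L : ℕ) [NeZero L] [NeZero (τ L)],
      let St := ZMod (τ L) × (Fin 3 → ZMod L);
      let Cfg := St × Option (Fin 3) → G;
      let ν : MeasureTheory.Measure Cfg := MeasureTheory.Measure.pi fun _ => Literature.MathematicalPhysics.QuantumFieldTheory.haarProbability G;
      let sh : St → Option (Fin 3) → St := fun x μ => Option.elim μ (x.1 + 1, x.2) fun i => (x.1, x.2 + Pi.single i 1);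
      let pl : Cfg → St → Option (Fin 3) → Option (Fin 3) → G := fun U x μ κ => U (x, μ) * U (sh x μ, κ) * (U (sh x κ, μ))⁻¹ * (U (x, κ))⁻¹;
      let act : Cfg → ℝ := fun U => β * ∑ x : St, ∑ i : Fin 3, (r.ρ (pl U x none (some i))).trace.re + β * ∑ x : St, ∑ q : {q : Fin 3 × Fin 3 // q.1 < q.2}, (r.ρ (pl U x (some q.1.1) (some q.1.2))).trace.re;
      let P : Cfg → (Fin 3 → ZMod L) → G := fun U x => (List.ofFn fun t : Fin (τ L) => U ((((t : ℕ) : ZMod (τ L)), x), none)).prod;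
      let wgt : Cfg → ℝ := fun U => Real.exp (act U - s * ∑ x : Fin 3 → ZMod L, V (P U x));
      let Ex : (Cfg → ℝ) → ℝ := fun F => (∫ U, F U * wgt U ∂ν) / (∫ U, wgt U ∂ν);
      let σ : ℕ → Cfg → Cfg := fun n U p => U ((p.1.1, p.1.2 + Pi.single 0 (n : ZMod L)), p.2);
      ∀ (c : Fin 3 → ZMod L),
      let Loc := fun F : Cfg → ℝ => Measurable F ∧ (∀ U, |F U| ≤ 1) ∧ ∀ U U', (∀ p, (∀ i : Fin 3, (p.1.2 i - c i).val ≤ w) → U p = U' p) → F U = F U';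
      ∀ F₁ F₂ : Cfg → ℝ, Loc F₁ → Loc F₂ → ∀ n : ℕ, 2 * n < L →
        |Ex (fun U => F₁ U * F₂ (σ n U)) - Ex F₁ * Ex (fun U => F₂ (σ n U))| ≤ C * Real.exp (-(m * n));
    ∀ (E : ℝ → ℝ) (β₂ : ℝ),
      (∀ β : ℝ, β₂ ≤ β → ∃ m : ℝ, 0 < m ∧ Cl (fun L => L) (E β) β m) →
      ∃ β₃ : ℝ, ∀ β : ℝ, β₃ ≤ β → ∃ m : ℝ, 0 < m ∧
        ∀ s : ℝ, 0 ≤ s → s ≤ E β → Cl (fun L => L) s β m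

/-- **Reducibility test** (scratch): `AnchorGap → UniformLatticeGap → DeformationRemoval`, pushed as far
as the quantifier prefixes honestly allow; the residual goal is left as `sorry`. -/
theorem deformationRemoval_of_items :
    Summit.QuantumFields.YangMills.Theses.SmallCircleAnchor.AnchorGap →
    Summit.QuantumFields.YangMills.Theses.SmallCircleAnchor.UniformLatticeGap →
    DeformationRemoval := by
  intro hAG hULG G _ _ _ _ hG
  letI : MeasurableSpace G := borel G
  haveI : BorelSpace G := ⟨rfl⟩
  intro r V hV Cl E β₂ hcorner
  -- (i) items at the crux's `G, r`: `AnchorGap` hands out ITS OWN `VA` (obstruction (1): R is `∀ V`).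
  obtain ⟨VA, hVA, hanchA⟩ := hAG G hG r
  obtain ⟨β₀U, hU⟩ := hULG G hG r
  -- (ii) `AnchorGap` lives on slabs `ZMod T × (ZMod L)³` with `T` FIXED before `L`; on the symmetric
  --      torus the temporal extent is `L` itself, so the only instantiations are `T := 1` (say) now, or
  --      `T := L` after `L` is introduced (then its threshold `βA(L)` and constants depend on `L`).
  obtain ⟨EA₁, hEA₁, βA₁, hβA₁⟩ := hanchA 1 0
  refine ⟨max β₂ (max β₀U βA₁), fun β hβ => ?_⟩
  have hβ2 : β₂ ≤ β := (le_max_left _ _).trans hβ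
  have hβU : β₀U ≤ β := (le_max_left _ _).trans ((le_max_right _ _).trans hβ)
  have hβA : βA₁ ≤ β := (le_max_right _ _).trans ((le_max_right _ _).trans hβ)
  -- R's own hypothesis at `β`: the fully deformed (`s = E β`) symmetric torus clusters — live, top slice only.
  obtain ⟨m₀, hm₀, hCl₀⟩ := hcorner β hβ2
  -- `UniformLatticeGap` at `β`: UNDEFORMED Wilson measure, odd symmetric tori `(2S+1)⁴`, `YMSpecies`.
  obtain ⟨mU, hmU, S₁, hUβ⟩ := hU β hβU
  obtain ⟨CU, hCU⟩ := hUβ r.curvature r.curvature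
  -- `AnchorGap` at extent `1`, coupling `β`: its own theory `(1, EA₁ β • VA)`.
  obtain ⟨mA₁, hmA₁, hClA₁⟩ := hβA₁ β hβA
  refine ⟨?m, ?hm, fun s hs0 hs1 w => ?g2⟩
  case g2 =>
    obtain ⟨C₀, hC₀⟩ := hCl₀ w
    obtain ⟨CA₁, hCA₁⟩ := hClA₁ w
    refine ⟨?C, fun L hL hτ => ?g3⟩
    case g3 =>
      -- (iii) `L` fixed: `AnchorGap` at extent `T := L` (threshold `s`): its own `EA`, own `βA(L)` produced
      --       after `β` (so only coupling `max β βA` is reachable), own `VA`, constants `CA(L, w)` — obstruction (2).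
      obtain ⟨EA, hEA, βA, hβA'⟩ := hanchA L s
      obtain ⟨mA, hmA, hClA⟩ := hβA' (max β βA) (le_max_right _ _)
      obtain ⟨CA, hCA⟩ := hClA w
      have hA' := @hCA L hL            -- right lattice `ZMod L × (ZMod L)³`, wrong theory, `L`-dependent constants
      have h₀ := @hC₀ L hL hτ          -- right lattice, right coupling, deformation `E β` instead of `s`
      have hA₁ := @hCA₁ L hL           -- extent-1 slab: wrong lattice and theory
      -- `hCU` : undeformed `latticeConnectedCorr` on `(2S+1)⁴` for `YMSpecies` — obstruction (3): even at
      -- `s = 0` no bridge `latticeConnectedCorr ⟹ inline Cl` (tube observables, all `L`) exists; the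
      -- tree's bridge `endpointTransfer_core` goes the other way.
      intro St Cfg ν sh pl act P wgt Ex σ c Loc F₁ F₂ hF₁ hF₂ n hn
      -- RESIDUAL GOAL (no hypothesis mentions the measure with weight `exp(act − s Σ V∘P)`, `0 ≤ s ≤ E β`):
      --   ⊢ |(Ex fun U => F₁ U * F₂ (σ n U)) - Ex F₁ * Ex fun U => F₂ (σ n U)| ≤ ?C * Real.exp (-(?m * ↑n))
      sorry
    case C => exact 1
  case m => exact 1
  case hm => exact one_pos

end Summit.QuantumFields.YangMills.Theorems.SmallCircleAnchor
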